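import Summits.BirchSwinnertonDyer.BirchSwinnertonDyer.Theorems.AdditiveBranchIMCGordTwoRankOneHeegnerKolyvaginIstarDoors
import HarnessLib

/-!
# Route `AdditiveBranchIMC` (rung K1), crux `GordTwoRankOne` (item 19358): the Heegner–Kolyvagin road,
# Part 23c — Part 23b's `Iₙ*` doors READ ON THE CELLS: (G-ord, `e = 2`) (crux 19358's rows) at EVERY odd `p`,
# and (G) ∧ ss (`e = 2`, the `p*`-twist good SUPERSINGULAR; programme row B4 'Gss2')
# (cell `bsd-addord`, second prover lane `bsd-addord-k1-c3x`, gen 6; `--supports` only)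

HONEST FRAMING. THEOREMS ONLY: no definition, no new named fact, no `sorry`; nothing is booked here; crux 19358
stays OPEN at class level; the (G) ∧ ss rows belong to cell `bsd-potss` at class level and nothing is asserted
about their cruxes; BSD is not proved by any of this. This file only instantiates Part 23b
(`…HeegnerKolyvaginIstarDoors`: UPPER(E,p) / `BSD(E,p)` at an additive prime of Kodaira type `Iₙ*`, every odd
`p`, from PUBLISHED facts + ONE unit Heegner twist) on the two `e = 2` cells: type `Iₙ*` holds on cell (G-ord,
`e = 2`) by Part 18a §29 (`N10.exists_kodairaSymbolAt_eq_Istar_of_cellGordTwo`) and on cell (G) ∧ ss by Part 23b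
§13 (`exists_kodairaSymbolAt_eq_Istar_of_subGss`). Per-pair data (`hq hv`, `hqd hvd`, `hcard`) are the books'
table / certificate currencies, discharged per pair, never asserted.

CENSUS USE (instrument `k1-c3x-inst1`, kit j292847, ledger of record A2 R977): the six live rank-one (G) ∧ ss
cells at `p = 3` with `#Ш(E)_an = 9`, `ρ̄_{E,3}` onto, `3 ∤ ∏c(E)` and a unit Heegner twist — 182853c1,
228897c1, 250065g1, 355338h1, 409248cy1, 439794p1 — are in the shape of
`bsdp_rankOne_subGss_of_cardSelmer_of_twistShaAnUnit` (one 3-descent certificate `9 ∣ #Sel^(3)(E/ℚ)` + the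
twist's value datum); the thirteen live (G-ord) cells (all `p ∈ {5,7}`, `#Ш_an = 1`) have non-surjective `ρ̄`
and are NOT in the shape (`hsurj`). Nothing is booked by this file.

References: [JetchevSkinnerWan2017] §7.4.1–7.4.3; [KolyvaginEulerSystems1990] Thm. A; [McCallumLMS1991] §1;
[SilvermanATAEC1994] IV.9.4 Steps 6–7; [SilvermanAEC2009] X.4.14; [Delbourgo1998] §1.5 (G); [Miller2011LMS] Def. 1.1.
-/

set_option autoImplicit false
set_option linter.dupNamespace false
noncomputable section
open scoped Classical NumberField
open WeierstrassCurve NumberField IsDedekindDomain IsDedekindDomain.HeightOneSpectrum Rat.HeightOneSpectrum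
  Literature.NumberTheory.DiophantineGeometry Literature.NumberTheory.EllipticCurves
  Literature.NumberTheory.EllipticCurves.ModularForms Literature.NumberTheory.EllipticCurves.Rank1Residual
  Literature.NumberTheory.EllipticCurves.Rank1Residual.Typed Literature.NumberTheory.Automorphic
  Summit.BirchSwinnertonDyer.Rank1Residual Summit.BirchSwinnertonDyer.Rank1Residual.Additive
  Summit.BirchSwinnertonDyer.Rank1Residual.X11b Summit.BirchSwinnertonDyer.Rank1Residual.GaloisImage
  Summit.BirchSwinnertonDyer.BirchSwinnertonDyer.Theses.AdditiveKolyvaginRoad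
  Summit.BirchSwinnertonDyer.BirchSwinnertonDyer.Theorems.AdditiveKolyvaginKernel
  Summit.BirchSwinnertonDyer.BirchSwinnertonDyer.Theorems

namespace Summit.BirchSwinnertonDyer.BirchSwinnertonDyer.Theorems.AdditiveBranchIMCGordTwoRankOne.HeegnerKolyvagin

/-! ### §17 Corollaries on cell (G-ord, `e = 2`) (crux 19358's rows) and on cell (G) ∧ ss (`e = 2`) -/

/-- **UPPER(E,p) on cell (G-ord, `e = 2`) ∩ `r_an = 1`, EVERY ODD `p`** (Part 19 §34 had `p ≥ 5`): type `Iₙ*`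
by Part 18a §29 `N10.exists_kodairaSymbolAt_eq_Istar_of_cellGordTwo`.
[cite: JetchevSkinnerWan2017, §7.4.2 (eq:shaupper), p. 31] [cite: McCallumLMS1991, §1 Theorem (Kolyvagin), p. 296]
[cite: SilvermanATAEC1994, IV.9.4 Steps 6–7] [cite: Miller2011LMS, Def. 1.1] -/
theorem missingUpperBoundAt_rankOne_cellGordTwo_odd_of_twistShaAnUnit
    (hGZ : ∀ (N : ℕ) [NeZero N] (W : WeierstrassCurve ℚ) (K : Type) [Field K] [NumberField K],
      gross_zagier N W K)
    (hKo : ∀ (N : ℕ) [NeZero N] (W : WeierstrassCurve ℚ) (K : Type) [Field K] [NumberField K],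
      kolyvagin N W K)
    (hB : ∀ (N : ℕ) [NeZero N] (W : WeierstrassCurve ℚ) (K : Type) [Field K] [NumberField K],
      Kolyvagin1990_padicValNat_card_sha_le N W K)
    (hGZK : rank_eq_analyticRank_of_analyticRank_le_one) (hmod : hasEntireLFunction_rat)
    (hnf : exists_isNewformOf)
    (hMz : mazur_not_dvd_maninConstant_of_odd)
    (hAU : abbesUllmo_not_dvd_maninConstant_of_not_dvd_level)
    (hC2 : cesnavicius_not_two_dvd_maninConstant_of_two_dvd_level)
    (W : WeierstrassCurve ℚ) [W.IsElliptic] [W.IsGloballyMinimal] (p : ℕ) [Fact p.Prime]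
    (K : Type) [Field K] [NumberField K]
    (Wd : WeierstrassCurve ℚ) [Wd.IsElliptic] [Wd.IsGloballyMinimal] (Cd : VariableChange ℚ)
    (hr : W.analyticRank = 1) (hc2 : N10.CellGordTwo W p)
    (hsurj : W.HasSurjectiveModNGaloisRep p) (htam : ¬ p ∣ W.tamagawaProduct)
    (hK : IsImaginaryQuadratic K) (hHN : SatisfiesHeegnerHypothesis (W.conductorNorm ℤ) K)
    (hLt : (W.quadraticTwist (NumberField.discr K : ℚ)).entireLFunction 1 ≠ 0)
    (hWd : Cd • W.quadraticTwist (NumberField.discr K : ℚ) = Wd)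
    {qd : ℚ} (hqd : shaAn Wd = (qd : ℂ)) (hvd : padicValRat p qd ≤ 0) :
    Typed.MissingUpperBoundAt W p :=
  missingUpperBoundAt_rankOne_istar_of_twistShaAnUnit hGZ hKo hB hGZK hmod hnf hMz hAU hC2 W p K Wd Cd hr hc2.1
    hc2.2.1 (N10.exists_kodairaSymbolAt_eq_Istar_of_cellGordTwo W p hc2) hsurj htam hK hHN hLt hWd hqd hvd

/-- **`BSD(E,p)` on cell (G-ord, `e = 2`) ∩ `r_an = 1`, EVERY ODD `p`, crux 19358's conclusion DISPLAYED at the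
pair** (`hlow`; free when `p ∤ #Ш(E)_an`). [cite: JetchevSkinnerWan2017, §7.4.1–7.4.3 (pp. 29–31)]
[cite: McCallumLMS1991, §1 Theorem (Kolyvagin), p. 296] [cite: Miller2011LMS, §1 and Def. 1.1] -/
theorem bsdp_rankOne_cellGordTwo_odd_of_lower_of_twistShaAnUnit
    (hGZ : ∀ (N : ℕ) [NeZero N] (W : WeierstrassCurve ℚ) (K : Type) [Field K] [NumberField K],
      gross_zagier N W K)
    (hKo : ∀ (N : ℕ) [NeZero N] (W : WeierstrassCurve ℚ) (K : Type) [Field K] [NumberField K],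
      kolyvagin N W K)
    (hB : ∀ (N : ℕ) [NeZero N] (W : WeierstrassCurve ℚ) (K : Type) [Field K] [NumberField K],
      Kolyvagin1990_padicValNat_card_sha_le N W K)
    (hGZK : rank_eq_analyticRank_of_analyticRank_le_one) (hmod : hasEntireLFunction_rat)
    (hnf : exists_isNewformOf)
    (hMz : mazur_not_dvd_maninConstant_of_odd)
    (hAU : abbesUllmo_not_dvd_maninConstant_of_not_dvd_level)
    (hC2 : cesnavicius_not_two_dvd_maninConstant_of_two_dvd_level)
    (W : WeierstrassCurve ℚ) [W.IsElliptic] [W.IsGloballyMinimal] (p : ℕ) [Fact p.Prime]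
    (K : Type) [Field K] [NumberField K]
    (Wd : WeierstrassCurve ℚ) [Wd.IsElliptic] [Wd.IsGloballyMinimal] (Cd : VariableChange ℚ)
    (hr : W.analyticRank = 1) (hc2 : N10.CellGordTwo W p)
    (hsurj : W.HasSurjectiveModNGaloisRep p) (htam : ¬ p ∣ W.tamagawaProduct)
    (hK : IsImaginaryQuadratic K) (hHN : SatisfiesHeegnerHypothesis (W.conductorNorm ℤ) K)
    (hLt : (W.quadraticTwist (NumberField.discr K : ℚ)).entireLFunction 1 ≠ 0)
    (hWd : Cd • W.quadraticTwist (NumberField.discr K : ℚ) = Wd)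
    {qd : ℚ} (hqd : shaAn Wd = (qd : ℂ)) (hvd : padicValRat p qd ≤ 0)
    (hlow : Typed.MissingLowerBoundAt W p) : BSDp W p :=
  bsdp_rankOne_istar_of_lower_of_twistShaAnUnit hGZ hKo hB hGZK hmod hnf hMz hAU hC2 W p K Wd Cd hr hc2.1 hc2.2.1
    (N10.exists_kodairaSymbolAt_eq_Istar_of_cellGordTwo W p hc2) hsurj htam hK hHN hLt hWd hqd hvd hlow

/-- **UPPER(E,p) on cell (G) ∧ ss (`e = 2`, the `p*`-twist good SUPERSINGULAR) ∩ `r_an = 1`, EVERY ODD `p`**: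
type `Iₙ*` by §13. Row: `p` odd, `Addv W p`, `SubGss W p`, `ρ̄_{E,p}` onto, `p ∤ ∏c(E)`; datum as in §15.
No ±/signed theory at the additive prime, no ordinarity anywhere.
[cite: JetchevSkinnerWan2017, §7.4.2 (eq:shaupper), p. 31] [cite: McCallumLMS1991, §1 Theorem (Kolyvagin), p. 296]
[cite: SilvermanATAEC1994, IV.9.4 Steps 6–7] [cite: Delbourgo1998, §1.5 (G)] [cite: Miller2011LMS, Def. 1.1] -/
theorem missingUpperBoundAt_rankOne_subGss_of_twistShaAnUnit
    (hGZ : ∀ (N : ℕ) [NeZero N] (W : WeierstrassCurve ℚ) (K : Type) [Field K] [NumberField K],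
      gross_zagier N W K)
    (hKo : ∀ (N : ℕ) [NeZero N] (W : WeierstrassCurve ℚ) (K : Type) [Field K] [NumberField K],
      kolyvagin N W K)
    (hB : ∀ (N : ℕ) [NeZero N] (W : WeierstrassCurve ℚ) (K : Type) [Field K] [NumberField K],
      Kolyvagin1990_padicValNat_card_sha_le N W K)
    (hGZK : rank_eq_analyticRank_of_analyticRank_le_one) (hmod : hasEntireLFunction_rat)
    (hnf : exists_isNewformOf)
    (hMz : mazur_not_dvd_maninConstant_of_odd)
    (hAU : abbesUllmo_not_dvd_maninConstant_of_not_dvd_level)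
    (hC2 : cesnavicius_not_two_dvd_maninConstant_of_two_dvd_level)
    (W : WeierstrassCurve ℚ) [W.IsElliptic] [W.IsGloballyMinimal] (p : ℕ) [Fact p.Prime]
    (K : Type) [Field K] [NumberField K]
    (Wd : WeierstrassCurve ℚ) [Wd.IsElliptic] [Wd.IsGloballyMinimal] (Cd : VariableChange ℚ)
    (hr : W.analyticRank = 1) (hp2 : p ≠ 2) (hadd : Addv W p) (hss : SubGss W p)
    (hsurj : W.HasSurjectiveModNGaloisRep p) (htam : ¬ p ∣ W.tamagawaProduct)
    (hK : IsImaginaryQuadratic K) (hHN : SatisfiesHeegnerHypothesis (W.conductorNorm ℤ) K)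
    (hLt : (W.quadraticTwist (NumberField.discr K : ℚ)).entireLFunction 1 ≠ 0)
    (hWd : Cd • W.quadraticTwist (NumberField.discr K : ℚ) = Wd)
    {qd : ℚ} (hqd : shaAn Wd = (qd : ℂ)) (hvd : padicValRat p qd ≤ 0) :
    Typed.MissingUpperBoundAt W p :=
  missingUpperBoundAt_rankOne_istar_of_twistShaAnUnit hGZ hKo hB hGZK hmod hnf hMz hAU hC2 W p K Wd Cd hr hp2 hadd
    (exists_kodairaSymbolAt_eq_Istar_of_subGss W p hp2 hadd hss) hsurj htam hK hHN hLt hWd hqd hvd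

/-- **`BSD(E,p)` on cell (G) ∧ ss (`e = 2`) ∩ `r_an = 1`, EVERY ODD `p`, content rows `ord_p #Ш(E)_an ≤ 2`: ONE
exact `p`-descent certificate `p^{r_an+1} ∣ #Sel^(p)(E/ℚ)` (LOWER, Cassels–Tate door) + ONE unit Heegner twist
(UPPER, §15) + PUBLISHED facts.** The per-pair road for the six live (G) ∧ ss rank-one cells at `p = 3` of the
module docstring. [cite: SilvermanAEC2009, Thm. X.4.14] [cite: JetchevSkinnerWan2017, §7.4.1–7.4.3 (pp. 29–31)]
[cite: McCallumLMS1991, §1 Theorem (Kolyvagin), p. 296] [cite: Delbourgo1998, §1.5 (G)] [cite: Miller2011LMS, §1 and Def. 1.1] -/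
theorem bsdp_rankOne_subGss_of_cardSelmer_of_twistShaAnUnit
    (hCT : exists_casselsTate_pairing (K := ℚ))
    (hGZ : ∀ (N : ℕ) [NeZero N] (W : WeierstrassCurve ℚ) (K : Type) [Field K] [NumberField K],
      gross_zagier N W K)
    (hKo : ∀ (N : ℕ) [NeZero N] (W : WeierstrassCurve ℚ) (K : Type) [Field K] [NumberField K],
      kolyvagin N W K)
    (hB : ∀ (N : ℕ) [NeZero N] (W : WeierstrassCurve ℚ) (K : Type) [Field K] [NumberField K],
      Kolyvagin1990_padicValNat_card_sha_le N W K)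
    (hGZK : rank_eq_analyticRank_of_analyticRank_le_one) (hmod : hasEntireLFunction_rat)
    (hnf : exists_isNewformOf)
    (hMz : mazur_not_dvd_maninConstant_of_odd)
    (hAU : abbesUllmo_not_dvd_maninConstant_of_not_dvd_level)
    (hC2 : cesnavicius_not_two_dvd_maninConstant_of_two_dvd_level)
    (W : WeierstrassCurve ℚ) [W.IsElliptic] [W.IsGloballyMinimal] (p : ℕ) [Fact p.Prime]
    (K : Type) [Field K] [NumberField K]
    (Wd : WeierstrassCurve ℚ) [Wd.IsElliptic] [Wd.IsGloballyMinimal] (Cd : VariableChange ℚ)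
    (hr : W.analyticRank = 1) (hp2 : p ≠ 2) (hadd : Addv W p) (hss : SubGss W p)
    (hsurj : W.HasSurjectiveModNGaloisRep p) (htam : ¬ p ∣ W.tamagawaProduct)
    (hK : IsImaginaryQuadratic K) (hHN : SatisfiesHeegnerHypothesis (W.conductorNorm ℤ) K)
    (hLt : (W.quadraticTwist (NumberField.discr K : ℚ)).entireLFunction 1 ≠ 0)
    (hWd : Cd • W.quadraticTwist (NumberField.discr K : ℚ) = Wd)
    {q : ℚ} (hq : shaAn W = (q : ℂ)) (hv2 : padicValRat p q ≤ 2)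
    (hcard : p ^ (W.analyticRank + 1) ∣ Nat.card (W.selmerGroup (p : ℤ)))
    {qd : ℚ} (hqd : shaAn Wd = (qd : ℂ)) (hvd : padicValRat p qd ≤ 0) : BSDp W p :=
  bsdp_rankOne_istar_of_cardSelmer_of_twistShaAnUnit hCT hGZ hKo hB hGZK hmod hnf hMz hAU hC2 W p K Wd Cd hr hp2
    hadd (exists_kodairaSymbolAt_eq_Istar_of_subGss W p hp2 hadd hss) hsurj htam hK hHN hLt hWd hq hv2 hcard hqd hvd

/-- **`BSD(E,p)` on cell (G) ∧ ss (`e = 2`) ∩ `r_an = 1`, EVERY ODD `p`, TWO unit data** (`p ∤ #Ш(E)_an`: LOWER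
free). [cite: JetchevSkinnerWan2017, §7.4.1–7.4.3 (pp. 29–31)] [cite: McCallumLMS1991, §1 Theorem (Kolyvagin), p. 296]
[cite: Delbourgo1998, §1.5 (G)] [cite: Miller2011LMS, §1 and Def. 1.1] -/
theorem bsdp_rankOne_subGss_of_shaAnUnit_of_twistShaAnUnit
    (hGZ : ∀ (N : ℕ) [NeZero N] (W : WeierstrassCurve ℚ) (K : Type) [Field K] [NumberField K],
      gross_zagier N W K)
    (hKo : ∀ (N : ℕ) [NeZero N] (W : WeierstrassCurve ℚ) (K : Type) [Field K] [NumberField K],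
      kolyvagin N W K)
    (hB : ∀ (N : ℕ) [NeZero N] (W : WeierstrassCurve ℚ) (K : Type) [Field K] [NumberField K],
      Kolyvagin1990_padicValNat_card_sha_le N W K)
    (hGZK : rank_eq_analyticRank_of_analyticRank_le_one) (hmod : hasEntireLFunction_rat)
    (hnf : exists_isNewformOf)
    (hMz : mazur_not_dvd_maninConstant_of_odd)
    (hAU : abbesUllmo_not_dvd_maninConstant_of_not_dvd_level)
    (hC2 : cesnavicius_not_two_dvd_maninConstant_of_two_dvd_level)
    (W : WeierstrassCurve ℚ) [W.IsElliptic] [W.IsGloballyMinimal] (p : ℕ) [Fact p.Prime]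
    (K : Type) [Field K] [NumberField K]
    (Wd : WeierstrassCurve ℚ) [Wd.IsElliptic] [Wd.IsGloballyMinimal] (Cd : VariableChange ℚ)
    (hr : W.analyticRank = 1) (hp2 : p ≠ 2) (hadd : Addv W p) (hss : SubGss W p)
    (hsurj : W.HasSurjectiveModNGaloisRep p) (htam : ¬ p ∣ W.tamagawaProduct)
    (hK : IsImaginaryQuadratic K) (hHN : SatisfiesHeegnerHypothesis (W.conductorNorm ℤ) K)
    (hLt : (W.quadraticTwist (NumberField.discr K : ℚ)).entireLFunction 1 ≠ 0)
    (hWd : Cd • W.quadraticTwist (NumberField.discr K : ℚ) = Wd)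
    {q : ℚ} (hq : shaAn W = (q : ℂ)) (hv : padicValRat p q ≤ 0)
    {qd : ℚ} (hqd : shaAn Wd = (qd : ℂ)) (hvd : padicValRat p qd ≤ 0) : BSDp W p :=
  bsdp_rankOne_istar_of_shaAnUnit_of_twistShaAnUnit hGZ hKo hB hGZK hmod hnf hMz hAU hC2 W p K Wd Cd hr hp2 hadd
    (exists_kodairaSymbolAt_eq_Istar_of_subGss W p hp2 hadd hss) hsurj htam hK hHN hLt hWd hq hv hqd hvd

end Summit.BirchSwinnertonDyer.BirchSwinnertonDyer.Theorems.AdditiveBranchIMCGordTwoRankOne.HeegnerKolyvagin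

end
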